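import Summits.QuantumFields.BalabanUV.Beta.EriceRemainderEnclosureHistoryAutonomyFunctionalShiftLimit
import Summits.QuantumFields.BalabanUV.Beta.EriceRemainderEnclosureHistoryAutonomyEnd

/-!
# EriceRemainderEnclosureHistoryAutonomyFunctionalShiftEnd — (E51d) THE ENDs OF THE FUNCTIONAL-SHIFT STATION: under node U2's binder list for ONE history family
# `β` in the simplified sharp regime (`InjectedRate`, `ScaleShiftRate`, `HistLipschitz Λ` with rows `Σ_i Λ k i ≤ M`, `EventualLowerH b`, `M·γ ≤ (3√3∕2)·b`,
# `M·γ³ ≤ 1∕2`) and a SECOND family `βt` (its own `InjectedRate` ∕ `ScaleShiftRate` ∕ `HistLipschitz`, the same eventual floor `b`) that is `ρ(a)`-CLOSE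
# to `β` on the sub-box histories `]0,a]^{k+1}` — the shape of a REMAINDER BOUND with profile `ρ` — the continuum running couplings `g⋆`, `g̃⋆` of ANY two
# lattice families of runs pinned at one `g_IR` satisfy: `|1∕(g⋆_m)² − 1∕(g̃⋆_m)²| ≤ 2e^{6M∕(b√b)}·Σ_{i≤m} ρ(c_i)` at every physical scale (`c_i` the floor
# envelope from `g_IR`); if `Σ_i ρ(c_i) < ∞` the level difference CONVERGES (a finite Λ-shift between the two continuum trajectories); and a uniform
# closeness `η` gives `|g⋆_m − g̃⋆_m| ≤ (2e^{6M∕(b√b)}+1)∕(b√b)·η∕√m` — the continuum couplings MERGE although their levels may separate like `m·η`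

Cell `pub-balaban`, β-function sub-cell, BINDER row D4 «RemainderConst leaves for Bałaban's split» (`HOME/BINDER-OWNERS.md`; owner lineage `b2b-balaban-beta-an4`;
this file by co-owner #2 lineage `b2b-balaban-beta-d4-p2`, generation 47), β-FLOW TEAM duty (1), FREEZE (0) honoured (def-free; node U2's `betaInf` ∕ `revHist` ∕
`tendsto_betaInf` ∕ `le_betaInf_of_eventualLower` ∕ `tendsto_invSq`, (E37a)'s `memFlow_gstar_of_injectedRate` ∕ `seqBox_gstar_of_tendsto`, (E37c)'s
`zerothMoment_betaInf_of_rows` ∕ `rowBound_nonneg` ∕ `abs_betaInf_sub_betaInf_le_of_close`, (E51a)'s `abs_disc_le_two_exp_mul_sum`, (E51b)'s `exists_tendsto_disc` ∕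
`abs_sub_le_of_uniform_excess` BY NAME, nothing restated; the binder lists are HYPOTHESES — NOT PRINTED (GAPS G-t4-U2-1∕-2), never facts).  Parallel to
(E48e) `…OrderEnd` (order in the pin) and (E49g) `…ComparisonEnd` (order in the functional); here: DISTANCE in the functional.

HONEST FRAMING (page 1, verbatim and binding).  *"Discharging BetaPertH makes Bałaban's UV stability UNCONDITIONAL — a real constructive-QFT result; it is
NOT the continuum limit and NOT the Clay problem."*  THIS FILE DISCHARGES NOTHING OF THE KIND.  It composes [folklore] real analysis over node U2's typed
HYPOTHESIS SHAPES on ABSTRACT families `β, βt : FlowStep.HBeta`; the sub-box closeness `|β k v − βt k v| ≤ ρ(a)` is a displayed binder of the SHAPE of a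
remainder bound — that Bałaban's `β_k` of [I] (1.22) and its one-loop part stand in such a relation with a given profile is row D4's OPEN discharge
(`RemainderConst`: `ρ ≡ r`) or NOT PRINTED (finer profiles), and is not asserted.  Row D4 class UNCHANGED (critical-path width 0; instance 0∕1; D4 DISCHARGE
NO DATE).  HONEST DEPENDENCY: continuum YM on T⁴ ⇐ BetaPertH ∧ nine spine estimates (0/9 proved); BetaPertH ⇐ (D1) ∧ (D4) ∧ CAP+tail; G-an2-4 gates asym,
D1 and NE2/3/4.

WHAT IS PROVED ([folklore]; 0 `def`, 0 sorry).  §1 **`abs_betaInf_sub_le_on_subbox`** (sub-box closeness of the lattice families ⟹ (E51a)'s excess hypothesis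
for `(betaInf β, betaInf βt)`).  §2 **`abs_invSq_gstar_sub_le`** (the level-shift END), **`exists_tendsto_invSq_gstar_sub`** (summable profile ⟹ the
continuum level difference converges), **`abs_gstar_sub_gstar_le_decay`** (uniform closeness `η` ⟹ `|g⋆_m − g̃⋆_m| ≤ (2e^{6M∕(b√b)}+1)∕(b√b)·η∕√m`, `m ≥ 1`).
-/

noncomputable section
open Filter Topology Finset

namespace Summit.QuantumFields.BalabanUV.Beta.EriceRemainderEnclosureHistoryAutonomyFunctionalShiftEnd

open Literature.MathematicalPhysics.QuantumFieldTheory.Balaban1983to89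
open Literature.MathematicalPhysics.QuantumFieldTheory.Balaban1983to89.FlowStep
open Literature.MathematicalPhysics.QuantumFieldTheory.Balaban1983to89.T4CouplingMatching
open Literature.MathematicalPhysics.QuantumFieldTheory.Balaban1983to89.T4CauchySum (InjectedRate)
open Literature.MathematicalPhysics.QuantumFieldTheory.Balaban1983to89.T4ContinuumCoupling
open Literature.MathematicalPhysics.QuantumFieldTheory.Balaban1983to89.T4BetaStationary
open Literature.MathematicalPhysics.QuantumFieldTheory.Balaban1983to89.T4BetaFlowWellPosed (MemFlow)
open Summit.QuantumFields.BalabanUV.Beta.EriceRemainderEnclosureHistoryAutonomy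
open Summit.QuantumFields.BalabanUV.Beta.EriceRemainderEnclosureHistoryAutonomyEnd
open Summit.QuantumFields.BalabanUV.Beta.EriceRemainderEnclosureHistoryAutonomyFunctionalShift
open Summit.QuantumFields.BalabanUV.Beta.EriceRemainderEnclosureHistoryAutonomyFunctionalShiftLimit

variable {β βt : HBeta} {γ c θs ct θst : ℝ} {Λ Λt : ℕ → ℕ → ℝ} {M : ℝ} {ρ : ℝ → ℝ}
variable {g gt : ℕ → ℕ → ℝ} {gIR C θ₁ Ct θt b : ℝ} {k₀ k₀t : ℕ}

/-! ## §1 Sub-box closeness of two lattice families passes to the limit functionals -/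

/-- **SUB-BOX CLOSENESS PASSES TO THE LIMIT FUNCTIONALS**: two history families with `ScaleShiftRate` (each its own constants) that are `ρ(a)`-close on
the sub-box histories `]0,a]^{k+1}` (`a ≤ γ`), `|β k v − βt k v| ≤ ρ(a)`, have `|betaInf β u − betaInf βt u| ≤ ρ(a)` on the `]0,a]`-valued histories — the
excess hypothesis `hρ` of (E51a)∕(E51b) for the pair `(betaInf β, betaInf βt)`, read off lattice data. [folklore] -/
theorem abs_betaInf_sub_le_on_subbox (hss : ScaleShiftRate c θs γ β) (hθs1 : θs < 1) (hsst : ScaleShiftRate ct θst γ βt) (hθst1 : θst < 1)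
    (hlat : ∀ a : ℝ, 0 < a → a ≤ γ → ∀ k v, v ∈ Box a k → |β k v - βt k v| ≤ ρ a) :
    ∀ a : ℝ, 0 < a → a ≤ γ → ∀ u, SeqBox a u → |betaInf β u - betaInf βt u| ≤ ρ a :=
  fun a ha haγ _ hu =>
    le_of_tendsto' (((tendsto_betaInf hss hθs1 (seqBox_mono haγ hu)).sub (tendsto_betaInf hsst hθst1 (seqBox_mono haγ hu))).abs)
      fun k => hlat a ha haγ k _ (revHist_mem_box hu k)

/-! ## §2 The ENDs: two lattice families, ρ-close on sub-boxes — how far apart are their continuum running couplings -/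

/-- **THE LEVEL SHIFT BETWEEN THE CONTINUUM RUNNING COUPLINGS OF TWO LATTICE FAMILIES.**  `β` under node U2's binder list (`ScaleShiftRate c θs γ β`,
`HistLipschitz Λ γ β` with `Λ ≥ 0` and rows `Σ_{i≤k} Λ k i ≤ M`, `EventualLowerH b γ k₀ β`, `b > 0`) in the simplified sharp regime `M·γ ≤ (3√3∕2)·b`,
`M·γ³ ≤ 1∕2`; a SECOND family `βt` with `ScaleShiftRate`, `HistLipschitz Λt` (ANY `Λt` — continuity only), the same eventual floor `EventualLowerH b γ k₀t βt`,
and `ρ(a)`-close to `β` on the sub-box histories; lattice families `g` (runs of `β`, `InjectedRate C 0 θ₁`) and `gt` (runs of `βt`, `InjectedRate Ct 0 θt`)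
in the box, BOTH pinned at `g_IR`.  Then at EVERY physical scale
`|1∕(g⋆_m)² − 1∕(g̃⋆_m)²| ≤ 2e^{6M∕(b√b)} · Σ_{i=1}^{m} ρ((1∕g_IR² + i·b)^{−1∕2})`.  Binders NOT PRINTED, never facts. [folklore] -/
theorem abs_invSq_gstar_sub_le (hθ1 : θ₁ < 1) (hinj : InjectedRate C 0 θ₁ (fun K j => disc (g K) (g (K + 1)) j))
    (hbox : ∀ K i, i ≤ K → 0 < g K i ∧ g K i ≤ γ) (hrun : ∀ K, RGEqH K β (g K)) (hpin : ∀ K, g K K = gIR)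
    (hθt1 : θt < 1) (hinjt : InjectedRate Ct 0 θt (fun K j => disc (gt K) (gt (K + 1)) j))
    (hboxt : ∀ K i, i ≤ K → 0 < gt K i ∧ gt K i ≤ γ) (hrunt : ∀ K, RGEqH K βt (gt K)) (hpint : ∀ K, gt K K = gIR)
    (hss : ScaleShiftRate c θs γ β) (hL : HistLipschitz Λ γ β) (hΛ : ∀ k i, i ≤ k → 0 ≤ Λ k i)
    (hrow : ∀ k, ∑ i ∈ range (k + 1), Λ k i ≤ M) (hθs0 : 0 ≤ θs) (hθs1 : θs < 1) (hev : EventualLowerH b γ k₀ β)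
    (hb : 0 < b) (hq : M * γ ≤ 3 * Real.sqrt 3 * b / 2) (hK : M * γ ^ 3 ≤ 1 / 2)
    (hsst : ScaleShiftRate ct θst γ βt) (hLt : HistLipschitz Λt γ βt) (hθst0 : 0 ≤ θst) (hθst1 : θst < 1)
    (hevt : EventualLowerH b γ k₀t βt)
    (hlat : ∀ a : ℝ, 0 < a → a ≤ γ → ∀ k v, v ∈ Box a k → |β k v - βt k v| ≤ ρ a) (m : ℕ) :
    |1 / gstar g m ^ 2 - 1 / gstar gt m ^ 2|
      ≤ 2 * Real.exp (6 * M / (b * Real.sqrt b)) * ∑ i ∈ range m, ρ (1 / Real.sqrt (1 / gIR ^ 2 + ((i : ℝ) + 1) * b)) := by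
  have hgIR : 0 < gIR := by rw [← hpin 0]; exact (hbox 0 0 le_rfl).1
  have hgIRγ : gIR ≤ γ := by rw [← hpin 0]; exact (hbox 0 0 le_rfl).2
  have hconv : ∀ m, Tendsto (invSq g m) atTop (𝓝 (astar g m)) := fun m => tendsto_invSq hθ1 hinj m
  have hconvt : ∀ m, Tendsto (invSq gt m) atTop (𝓝 (astar gt m)) := fun m => tendsto_invSq hθt1 hinjt m
  exact abs_disc_le_two_exp_mul_sum (zerothMoment_betaInf_of_rows hss hθs1 hL hΛ hrow) (rowBound_nonneg hΛ hrow) hgIR hgIRγ hb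
    (fun u hu => le_betaInf_of_eventualLower hss hθs1 hev hu) (fun u hu => le_betaInf_of_eventualLower hsst hθst1 hevt hu) hq hK
    (abs_betaInf_sub_le_on_subbox hss hθs1 hsst hθst1 hlat) (seqBox_gstar_of_tendsto hbox hconv) (seqBox_gstar_of_tendsto hboxt hconvt)
    (memFlow_gstar_of_injectedRate hθ1 hinj hbox hrun hpin hss hL hθs0 hθs1)
    (memFlow_gstar_of_injectedRate hθt1 hinjt hboxt hrunt hpint hsst hLt hθst0 hθst1) m

/-- **A SUMMABLE LATTICE PERTURBATION IS A FINITE Λ-SHIFT OF THE CONTINUUM RUNNING COUPLING**: under the same binders, if `Σ_{i≥1} ρ((1∕g_IR² + i·b)^{−1∕2})`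
converges then `1∕(g⋆_m)² − 1∕(g̃⋆_m)²` CONVERGES as `m → ∞` (to some `δ_∞` with `|δ_∞| ≤ 2e^{6M∕(b√b)}·Σ_{i≥1} ρ(c_i)`): the two continuum trajectories have
asymptotically parallel levels. [folklore] -/
theorem exists_tendsto_invSq_gstar_sub (hθ1 : θ₁ < 1) (hinj : InjectedRate C 0 θ₁ (fun K j => disc (g K) (g (K + 1)) j))
    (hbox : ∀ K i, i ≤ K → 0 < g K i ∧ g K i ≤ γ) (hrun : ∀ K, RGEqH K β (g K)) (hpin : ∀ K, g K K = gIR)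
    (hθt1 : θt < 1) (hinjt : InjectedRate Ct 0 θt (fun K j => disc (gt K) (gt (K + 1)) j))
    (hboxt : ∀ K i, i ≤ K → 0 < gt K i ∧ gt K i ≤ γ) (hrunt : ∀ K, RGEqH K βt (gt K)) (hpint : ∀ K, gt K K = gIR)
    (hss : ScaleShiftRate c θs γ β) (hL : HistLipschitz Λ γ β) (hΛ : ∀ k i, i ≤ k → 0 ≤ Λ k i)
    (hrow : ∀ k, ∑ i ∈ range (k + 1), Λ k i ≤ M) (hθs0 : 0 ≤ θs) (hθs1 : θs < 1) (hev : EventualLowerH b γ k₀ β)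
    (hb : 0 < b) (hq : M * γ ≤ 3 * Real.sqrt 3 * b / 2) (hK : M * γ ^ 3 ≤ 1 / 2)
    (hsst : ScaleShiftRate ct θst γ βt) (hLt : HistLipschitz Λt γ βt) (hθst0 : 0 ≤ θst) (hθst1 : θst < 1)
    (hevt : EventualLowerH b γ k₀t βt)
    (hlat : ∀ a : ℝ, 0 < a → a ≤ γ → ∀ k v, v ∈ Box a k → |β k v - βt k v| ≤ ρ a)
    (hsum : Summable fun i : ℕ => ρ (1 / Real.sqrt (1 / gIR ^ 2 + ((i : ℝ) + 1) * b))) :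
    ∃ δ : ℝ, Tendsto (fun m => 1 / gstar g m ^ 2 - 1 / gstar gt m ^ 2) atTop (𝓝 δ)
      ∧ |δ| ≤ 2 * Real.exp (6 * M / (b * Real.sqrt b)) * ∑' i : ℕ, ρ (1 / Real.sqrt (1 / gIR ^ 2 + ((i : ℝ) + 1) * b)) := by
  have hgIR : 0 < gIR := by rw [← hpin 0]; exact (hbox 0 0 le_rfl).1
  have hgIRγ : gIR ≤ γ := by rw [← hpin 0]; exact (hbox 0 0 le_rfl).2
  have hconv : ∀ m, Tendsto (invSq g m) atTop (𝓝 (astar g m)) := fun m => tendsto_invSq hθ1 hinj m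
  have hconvt : ∀ m, Tendsto (invSq gt m) atTop (𝓝 (astar gt m)) := fun m => tendsto_invSq hθt1 hinjt m
  exact exists_tendsto_disc (zerothMoment_betaInf_of_rows hss hθs1 hL hΛ hrow) (rowBound_nonneg hΛ hrow) hgIR hgIRγ hb
    (fun u hu => le_betaInf_of_eventualLower hss hθs1 hev hu) (fun u hu => le_betaInf_of_eventualLower hsst hθst1 hevt hu) hq hK
    (abs_betaInf_sub_le_on_subbox hss hθs1 hsst hθst1 hlat) hsum (seqBox_gstar_of_tendsto hbox hconv) (seqBox_gstar_of_tendsto hboxt hconvt)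
    (memFlow_gstar_of_injectedRate hθ1 hinj hbox hrun hpin hss hL hθs0 hθs1)
    (memFlow_gstar_of_injectedRate hθt1 hinjt hboxt hrunt hpint hsst hLt hθst0 hθst1)

/-- **UNIFORMLY CLOSE LATTICE FAMILIES HAVE MERGING CONTINUUM COUPLINGS**: under the same binders with `|β k v − βt k v| ≤ η` on every box, for `m ≥ 1`
`|g⋆_m − g̃⋆_m| ≤ (2e^{6M∕(b√b)} + 1)∕(b√b) · η∕√m` (node U2's scale-uniform `abs_gstar_sub_gstar_le_of_betaInf_close`, sharpened by asymptotic freedom),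
while the levels may separate like `m·η`. [folklore] -/
theorem abs_gstar_sub_gstar_le_decay {η : ℝ} (hθ1 : θ₁ < 1) (hinj : InjectedRate C 0 θ₁ (fun K j => disc (g K) (g (K + 1)) j))
    (hbox : ∀ K i, i ≤ K → 0 < g K i ∧ g K i ≤ γ) (hrun : ∀ K, RGEqH K β (g K)) (hpin : ∀ K, g K K = gIR)
    (hθt1 : θt < 1) (hinjt : InjectedRate Ct 0 θt (fun K j => disc (gt K) (gt (K + 1)) j))
    (hboxt : ∀ K i, i ≤ K → 0 < gt K i ∧ gt K i ≤ γ) (hrunt : ∀ K, RGEqH K βt (gt K)) (hpint : ∀ K, gt K K = gIR)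
    (hss : ScaleShiftRate c θs γ β) (hL : HistLipschitz Λ γ β) (hΛ : ∀ k i, i ≤ k → 0 ≤ Λ k i)
    (hrow : ∀ k, ∑ i ∈ range (k + 1), Λ k i ≤ M) (hθs0 : 0 ≤ θs) (hθs1 : θs < 1) (hev : EventualLowerH b γ k₀ β)
    (hb : 0 < b) (hq : M * γ ≤ 3 * Real.sqrt 3 * b / 2) (hK : M * γ ^ 3 ≤ 1 / 2)
    (hsst : ScaleShiftRate ct θst γ βt) (hLt : HistLipschitz Λt γ βt) (hθst0 : 0 ≤ θst) (hθst1 : θst < 1)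
    (hevt : EventualLowerH b γ k₀t βt) (hclose : ∀ k v, v ∈ Box γ k → |β k v - βt k v| ≤ η) {m : ℕ} (hm : 1 ≤ m) :
    |gstar g m - gstar gt m| ≤ (2 * Real.exp (6 * M / (b * Real.sqrt b)) + 1) / (b * Real.sqrt b) * (η / Real.sqrt (m : ℝ)) := by
  have hgIR : 0 < gIR := by rw [← hpin 0]; exact (hbox 0 0 le_rfl).1
  have hgIRγ : gIR ≤ γ := by rw [← hpin 0]; exact (hbox 0 0 le_rfl).2
  have hconv : ∀ m, Tendsto (invSq g m) atTop (𝓝 (astar g m)) := fun m => tendsto_invSq hθ1 hinj m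
  have hconvt : ∀ m, Tendsto (invSq gt m) atTop (𝓝 (astar gt m)) := fun m => tendsto_invSq hθt1 hinjt m
  exact abs_sub_le_of_uniform_excess (zerothMoment_betaInf_of_rows hss hθs1 hL hΛ hrow) (rowBound_nonneg hΛ hrow) hgIR hgIRγ hb
    (fun u hu => le_betaInf_of_eventualLower hss hθs1 hev hu) (fun u hu => le_betaInf_of_eventualLower hsst hθst1 hevt hu) hq hK
    (fun u hu => abs_betaInf_sub_betaInf_le_of_close hss hθs1 hsst hθst1 hclose hu) (seqBox_gstar_of_tendsto hbox hconv)
    (seqBox_gstar_of_tendsto hboxt hconvt) (memFlow_gstar_of_injectedRate hθ1 hinj hbox hrun hpin hss hL hθs0 hθs1)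
    (memFlow_gstar_of_injectedRate hθt1 hinjt hboxt hrunt hpint hsst hLt hθst0 hθst1) hm

end Summit.QuantumFields.BalabanUV.Beta.EriceRemainderEnclosureHistoryAutonomyFunctionalShiftEnd

end
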